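import Literature.NumberTheory.LFunctions.SelbergClass
import Literature.NumberTheory.LFunctions.GeneralizedRH
import HarnessLib

/-!
# The Selberg class: the degree is well defined (discharge of `degree_eq_of_toFun_eq`)

Sibling proofs file (D-0014 append protocol) for
`Literature/NumberTheory/LFunctions/SelbergClass.lean`. It proves the named facts

* `Literature.SelbergDatum.degree_eq_of_toFun_eq_holds : degree_eq_of_toFun_eq` — two Selberg data with
  the same function `F` have the same degree `2 ∑ⱼ λⱼ` (Conrey–Ghosh, Duke Math. J. **72** (1993),
  §2, paragraph "Degree").
* `Literature.SelbergDatum.riemannHypothesis_iff_of_toFun_eq_riemannZeta_holds :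
  riemannHypothesis_iff_of_toFun_eq_riemannZeta` — for a Selberg datum whose function is `ζ`, the
  strip-form Riemann hypothesis is equivalent to Mathlib's `RiemannHypothesis` (the zeros of `ζ`
  outside the open critical strip are the trivial zeros; Titchmarsh §2.12 and §3.1), via
  `Literature.NumberTheory.LFunctions.riemannHypothesis_iff_strip_holds` (`GeneralizedRH.lean`); see the last section.
* `Literature.SelbergDatum.differentiableOn_completed_holds : D.differentiableOn_completed` — the
  completed function `Φ(s) = Q^s ∏ⱼ Γ(λⱼ s + μⱼ) F(s)` is holomorphic on `{s | 0 < re s, s ≠ 1}`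
  (Kaczorowski–Perelli survey (1999), §1: immediate from axioms (ii) `(s - 1)^m F(s)` entire and
  (iii) `Q > 0`, `λⱼ > 0`, `re μⱼ ≥ 0`, so that `re (λⱼ s + μⱼ) > 0` and `Γ` has no pole there;
  see the section "Holomorphy of the completed function" at the end of this file).

The file is a pure proof file: it introduces no definitions; the auxiliary functions below are
written out in full in every statement.

## The printed argument and its formalisation

Conrey–Ghosh (loc. cit.): *"if `γ⁽¹⁾(s)` and `γ⁽²⁾(s)` are two admissible gamma factors for `F` with
degrees `d⁽¹⁾` and `d⁽²⁾`, then `d⁽¹⁾ = d⁽²⁾`. For, if we form the quotient of the two functional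
equations for `F`, say `h = γ⁽¹⁾/γ⁽²⁾`, we obtain `h(s) = conj h(1 - s̄)`. Now the left side is regular
and non-zero in `σ > 0` and the right side is regular and nonzero in `σ < 1`. Hence, `h(s)` is an
entire non-vanishing function. If the degrees were different, then `h` would have zeros or poles."*

We make the last sentence quantitative by counting poles with multiplicity (this avoids Stirling's
formula). Write `P_D(s) = ∏ⱼ Γ(λⱼ s + μⱼ)⁻¹` (entire) and `P_D†(w) = ∏ⱼ Γ(λⱼ w + conj μⱼ)⁻¹` for a
Selberg datum `D = (Q, λ, μ, ω)`.

1. (`crossGamma_comm`) Pushing `conj` inside the functional equation (`Γ(s̄) = conj Γ(s)`,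
   `Q^{s̄} = conj (Q^s)`) and multiplying by the entire reciprocals `P_D`, `P_D†` turns the two
   functional equations of a common `F` into `Φ · F = 0` on the open critical strip, where
   `Φ(s) = ω₂ Q₂^{1-s} Q₁^s P₁†(1-s) P₂(s) - ω₁ Q₁^{1-s} Q₂^s P₂†(1-s) P₁(s)` is entire. The
   continuation axiom and the identity theorem give `Φ · G ≡ 0` (`G = (s-1)^m F` entire);
   non-vanishing of `F` on `re s > 1` (Euler product) gives `Φ = 0` there, hence `Φ ≡ 0`.
2. (`poleCount_eq_of_toFun_eq`) Reading off orders of vanishing (`analyticOrderAt`) at any `s₀`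
   with `re s₀ < 1`, where the cofactors `ω Q'^{1-s} Q^s P†(1-s)` are analytic and non-zero: the
   number of `j` with `λⱼ s₀ + μⱼ ∈ -ℕ` is the same for both data (the reciprocal Gamma function
   has simple zeros at `-n`, `analyticOrderAt_inv_Gamma_neg_nat`).
3. (`sum_lam_le_of_poleCount_eq`) Summing over the finite set of all poles `-(n + μⱼ)/λⱼ` of either
   datum with real part `≥ -X` gives `∑ⱼ #{n : n + re μⱼ ≤ λⱼ X}` for both data; since
   `#{n : n ≤ Y} = ⌊Y + 1⌋₊ ∈ (Y, Y + 1]` for `Y ≥ -1`, letting `X → ∞` yields `∑ⱼ λ⁽¹⁾ⱼ = ∑ₖ λ⁽²⁾ₖ`.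

## References

* J. B. Conrey, A. Ghosh, *On the Selberg class of Dirichlet series: small degrees*,
  Duke Math. J. **72** (1993), 673–693, §2. [ConreyGhosh1993]
* E. C. Titchmarsh, *The Theory of the Riemann Zeta-Function*, 2nd ed. revised by
  D. R. Heath-Brown, Oxford 1986, §2.12 and §3.1. [Titchmarsh1986]
* J. Kaczorowski, A. Perelli, *The Selberg class: a survey*, in: Number Theory in Progress,
  Vol. 2 (Zakopane 1997), de Gruyter 1999, 953–992, §1. [KaczorowskiPerelli1999]
  (The axioms (i)–(v) of `𝒮` are restated verbatim by the same authors in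
  *Lower bounds for the conductor of L-functions*, Acta Arith. **155** (2012), 185–200, p. 185.)
-/

noncomputable section

open Complex Filter Topology Set
open scoped ComplexConjugate

namespace Literature.NumberTheory.LFunctions

namespace SelbergDatum

/-! ## The reciprocal Gamma function: simple zeros at `-n` -/

/-- `Γ(z)⁻¹ = (∏_{k<m} (z + k)) · Γ(z + m)⁻¹`, the iterated form of Mathlib's
`one_div_Gamma_eq_self_mul_one_div_Gamma_add_one` (valid at the poles too). [folklore] -/
lemma inv_Gamma_eq_prod_mul_inv_Gamma_add (z : ℂ) (m : ℕ) :
    (Gamma z)⁻¹ = (∏ k ∈ Finset.range m, (z + k)) * (Gamma (z + m))⁻¹ := by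
  induction m with
  | zero => simp
  | succ m ih =>
    rw [ih, Finset.prod_range_succ, Complex.one_div_Gamma_eq_self_mul_one_div_Gamma_add_one (z + m),
      show z + (m : ℂ) + 1 = z + ((m + 1 : ℕ) : ℂ) by push_cast; ring]
    ring

/-- The entire function `Γ⁻¹` has a simple zero at `-n`, `n ∈ ℕ`. [folklore] -/
lemma analyticOrderAt_inv_Gamma_neg_nat (n : ℕ) :
    analyticOrderAt (fun z ↦ (Gamma z)⁻¹) (-(n : ℂ)) = 1 := by
  have hR : AnalyticAt ℂ (fun z ↦ (Gamma z)⁻¹) (-(n : ℂ)) :=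
    Complex.differentiable_one_div_Gamma.analyticAt _
  rw [show (1 : ℕ∞) = ((1 : ℕ) : ℕ∞) from rfl, hR.analyticOrderAt_eq_natCast]
  refine ⟨fun z ↦ (∏ k ∈ Finset.range n, (z + k)) * (Gamma (z + ((n + 1 : ℕ) : ℂ)))⁻¹, ?_, ?_, ?_⟩
  · apply AnalyticAt.mul
    · exact Finset.analyticAt_fun_prod _ fun k _ ↦ by fun_prop
    · exact (Complex.differentiable_one_div_Gamma.comp
        (differentiable_id.add_const _)).analyticAt _
  · have h1 : -(n : ℂ) + ((n + 1 : ℕ) : ℂ) = 1 := by push_cast; ring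
    dsimp only
    rw [h1, Complex.Gamma_one, inv_one, mul_one]
    refine Finset.prod_ne_zero_iff.mpr fun k hk h ↦ ?_
    have hk' : k < n := Finset.mem_range.mp hk
    have : (k : ℂ) = n := by linear_combination h
    exact hk'.ne (by exact_mod_cast this)
  · filter_upwards with z
    rw [inv_Gamma_eq_prod_mul_inv_Gamma_add z (n + 1), Finset.prod_range_succ, smul_eq_mul, pow_one,
      sub_neg_eq_add]
    ring

open scoped Classical in
/-- The order of vanishing of `s ↦ Γ(λ s + μ)⁻¹` (`λ ≠ 0` real) at `s₀` is `1` if `λ s₀ + μ ∈ -ℕ`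
and `0` otherwise. [folklore] -/
lemma analyticOrderAt_inv_Gamma_affine (l : ℝ) (hl : l ≠ 0) (μ s₀ : ℂ) :
    analyticOrderAt (fun s ↦ (Gamma (l * s + μ))⁻¹) s₀ =
      if ∃ n : ℕ, (l : ℂ) * s₀ + μ = -n then 1 else 0 := by
  have hderiv : HasDerivAt (fun s : ℂ ↦ (l : ℂ) * s + μ) (l : ℂ) s₀ := by
    simpa using ((hasDerivAt_id s₀).const_mul (l : ℂ)).add_const μ
  have hd : deriv (fun s : ℂ ↦ (l : ℂ) * s + μ) s₀ ≠ 0 := by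
    rw [hderiv.deriv]; exact_mod_cast hl
  rw [show (fun s ↦ (Gamma (l * s + μ))⁻¹) = (fun z ↦ (Gamma z)⁻¹) ∘ (fun s ↦ (l : ℂ) * s + μ)
    from rfl, analyticOrderAt_comp_of_deriv_ne_zero (by fun_prop) hd]
  split_ifs with h
  · obtain ⟨n, hn⟩ := h
    rw [hn]
    exact analyticOrderAt_inv_Gamma_neg_nat n
  · push Not at h
    rw [(Complex.differentiable_one_div_Gamma.analyticAt _).analyticOrderAt_eq_zero]
    exact inv_ne_zero (Complex.Gamma_ne_zero h)

/-- The order of vanishing of a finite product of analytic functions is the sum of the orders.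
[folklore] -/
lemma analyticOrderAt_finset_prod {ι : Type*} (S : Finset ι) (f : ι → ℂ → ℂ) (z₀ : ℂ)
    (h : ∀ i ∈ S, AnalyticAt ℂ (f i) z₀) :
    analyticOrderAt (∏ i ∈ S, f i) z₀ = ∑ i ∈ S, analyticOrderAt (f i) z₀ := by
  classical
  induction S using Finset.cons_induction with
  | empty =>
    simp only [Finset.prod_empty, Finset.sum_empty]
    exact analyticOrderAt_eq_zero.mpr (Or.inr one_ne_zero)
  | cons a S ha ih =>
    rw [Finset.prod_cons, Finset.sum_cons,
      analyticOrderAt_mul (h a (Finset.mem_cons_self a S))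
        (Finset.analyticAt_prod S fun i hi ↦ h i (Finset.mem_cons_of_mem hi)),
      ih fun i hi ↦ h i (Finset.mem_cons_of_mem hi)]

/-! ## The entire reciprocal `P(λ, μ; s) = ∏ⱼ Γ(λⱼ s + μⱼ)⁻¹` of a gamma product -/

section invGammaProd

variable {N : ℕ} (lam : Fin N → ℝ) (mu : Fin N → ℂ)

/-- `s ↦ ∏ⱼ Γ(λⱼ s + μⱼ)⁻¹` is entire. [folklore] -/
lemma differentiable_prod_inv_Gamma :
    Differentiable ℂ fun s : ℂ ↦ ∏ j, (Gamma (lam j * s + mu j))⁻¹ :=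
  Differentiable.fun_finsetProd fun _ _ ↦
    Complex.differentiable_one_div_Gamma.comp ((differentiable_id.const_mul _).add_const _)

/-- `(∏ⱼ Γ(λⱼ s + μⱼ)⁻¹) · ∏ⱼ Γ(λⱼ s + μⱼ) = 1` away from the poles. [folklore] -/
lemma prod_inv_Gamma_mul_prod_Gamma (s : ℂ) (h : ∀ j, Gamma (lam j * s + mu j) ≠ 0) :
    (∏ j, (Gamma (lam j * s + mu j))⁻¹) * ∏ j, Gamma (lam j * s + mu j) = 1 := by
  rw [← Finset.prod_mul_distrib]
  exact Finset.prod_eq_one fun j _ ↦ inv_mul_cancel₀ (h j)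

/-- `∏ⱼ Γ(λⱼ s + μⱼ)⁻¹ ≠ 0` away from the poles. [folklore] -/
lemma prod_inv_Gamma_ne_zero (s : ℂ) (h : ∀ j, Gamma (lam j * s + mu j) ≠ 0) :
    ∏ j, (Gamma (lam j * s + mu j))⁻¹ ≠ 0 :=
  Finset.prod_ne_zero_iff.mpr fun j _ ↦ inv_ne_zero (h j)

open scoped Classical in
/-- The order of vanishing of `s ↦ ∏ⱼ Γ(λⱼ s + μⱼ)⁻¹` at `s₀` is the number of `j` with
`λⱼ s₀ + μⱼ ∈ -ℕ` (all `λⱼ ≠ 0`). [folklore] -/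
lemma analyticOrderAt_prod_inv_Gamma (hlam : ∀ j, lam j ≠ 0) (s₀ : ℂ) :
    analyticOrderAt (fun s : ℂ ↦ ∏ j, (Gamma (lam j * s + mu j))⁻¹) s₀ =
      ((∑ j, if ∃ n : ℕ, (lam j : ℂ) * s₀ + mu j = -n then 1 else 0 : ℕ) : ℕ∞) := by
  have hfun : (fun s : ℂ ↦ ∏ j, (Gamma (lam j * s + mu j))⁻¹) =
      ∏ j, fun s ↦ (Gamma (lam j * s + mu j))⁻¹ := by
    funext s
    simp only [Finset.prod_apply]
  have hana : ∀ j ∈ Finset.univ, AnalyticAt ℂ (fun s ↦ (Gamma (lam j * s + mu j))⁻¹) s₀ :=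
    fun j _ ↦ (Complex.differentiable_one_div_Gamma.comp
      ((differentiable_id.const_mul _).add_const _)).analyticAt _
  rw [hfun, analyticOrderAt_finset_prod _ _ _ hana]
  push_cast
  exact Finset.sum_congr rfl fun j _ ↦ by
    rw [analyticOrderAt_inv_Gamma_affine (lam j) (hlam j) (mu j) s₀]

end invGammaProd

/-! ## The functional equations cross-multiplied -/

variable (D : SelbergDatum)

/-- `re (λ s + μ) = λ re s + re μ` for real `λ`. [folklore] -/
lemma re_lam_mul_add (l : ℝ) (m s : ℂ) : ((l : ℂ) * s + m).re = l * s.re + m.re := by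
  simp [Complex.mul_re]

/-- The gamma factors of a Selberg datum have no poles in the right half-plane:
`Γ(λⱼ s + μⱼ) ≠ 0` for `re s > 0` (`λⱼ > 0`, `re μⱼ ≥ 0`). [folklore] -/
lemma Gamma_lam_mul_add_mu_ne_zero (s : ℂ) (hs : 0 < s.re) (j : Fin D.numGamma) :
    Gamma (D.lam j * s + D.mu j) ≠ 0 := by
  apply Complex.Gamma_ne_zero_of_re_pos
  rw [re_lam_mul_add]
  have := D.lam_pos j
  have := D.mu_re_nonneg j
  positivity

/-- `Γ(λⱼ (1 - s) + conj μⱼ) ≠ 0` for `re s < 1`. [folklore] -/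
lemma Gamma_lam_mul_one_sub_add_conj_mu_ne_zero (s : ℂ) (hs : s.re < 1) (j : Fin D.numGamma) :
    Gamma (D.lam j * (1 - s) + conj (D.mu j)) ≠ 0 := by
  apply Complex.Gamma_ne_zero_of_re_pos
  rw [re_lam_mul_add, Complex.conj_re, Complex.sub_re, Complex.one_re]
  have := D.lam_pos j
  have := D.mu_re_nonneg j
  nlinarith

/-- `Q ≠ 0` in `ℂ` (as `Q > 0`). [folklore] -/
lemma Q_ne_zero : (D.Q : ℂ) ≠ 0 := Complex.ofReal_ne_zero.mpr D.Q_pos.ne'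

/-- The root number is non-zero (`‖ω‖ = 1`). [folklore] -/
lemma rootNumber_ne_zero : D.rootNumber ≠ 0 := by
  rw [← norm_ne_zero_iff, D.norm_rootNumber]; exact one_ne_zero

/-- The functional equation with the conjugation pushed inside:
`Q^s ∏ Γ(λⱼ s + μⱼ) F(s) = ω Q^{1-s} ∏ Γ(λⱼ (1-s) + conj μⱼ) conj F(1 - s̄)` on the open strip
(Selberg 1992, axiom (iii); `Γ(s̄) = conj Γ(s)`, `Q^{s̄} = conj (Q^s)` for `Q > 0`). [cite: Selberg1992, axiom (iii)] -/
lemma functional_equation_conj (s : ℂ) (h0 : 0 < s.re) (h1 : s.re < 1) :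
    (D.Q : ℂ) ^ s * (∏ j, Gamma (D.lam j * s + D.mu j)) * D.toFun s =
      D.rootNumber * ((D.Q : ℂ) ^ (1 - s) * (∏ j, Gamma (D.lam j * (1 - s) + conj (D.mu j))) *
        conj (D.toFun (1 - conj s))) := by
  have hQ : conj ((D.Q : ℂ) ^ (1 - conj s)) = (D.Q : ℂ) ^ (1 - s) := by
    have harg : (D.Q : ℂ).arg ≠ Real.pi := by
      rw [Complex.arg_ofReal_of_nonneg D.Q_pos.le]; exact Real.pi_pos.ne
    rw [show (1 : ℂ) - conj s = conj (1 - s) by simp [map_sub], Complex.cpow_conj _ _ harg,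
      Complex.conj_conj, Complex.conj_ofReal]
  have hG : ∀ j, conj (Gamma (D.lam j * (1 - conj s) + D.mu j)) =
      Gamma (D.lam j * (1 - s) + conj (D.mu j)) := fun j ↦ by
    rw [← Complex.Gamma_conj]
    congr 1
    simp [map_sub, Complex.conj_ofReal]
  rw [D.functional_equation s h0 h1, map_mul, map_mul, map_prod, hQ]
  simp only [hG]

/-- From the functional equation: `Q^s P†(1-s) F(s) = ω Q^{1-s} P(s) conj F(1 - s̄)` on the strip,
where `P(s) = ∏ⱼ Γ(λⱼ s + μⱼ)⁻¹` and `P†(w) = ∏ⱼ Γ(λⱼ w + conj μⱼ)⁻¹` are entire. [folklore] -/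
lemma fe_prod_inv_Gamma (s : ℂ) (h0 : 0 < s.re) (h1 : s.re < 1) :
    (D.Q : ℂ) ^ s * (∏ j, (Gamma (D.lam j * (1 - s) + conj (D.mu j)))⁻¹) * D.toFun s =
      D.rootNumber * (D.Q : ℂ) ^ (1 - s) * (∏ j, (Gamma (D.lam j * s + D.mu j))⁻¹) *
        conj (D.toFun (1 - conj s)) := by
  have FE := D.functional_equation_conj s h0 h1
  have u1 := prod_inv_Gamma_mul_prod_Gamma D.lam D.mu s (D.Gamma_lam_mul_add_mu_ne_zero s h0)
  have u2 := prod_inv_Gamma_mul_prod_Gamma D.lam (fun j ↦ conj (D.mu j)) (1 - s)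
    (D.Gamma_lam_mul_one_sub_add_conj_mu_ne_zero s h1)
  linear_combination
    ((∏ j, (Gamma (D.lam j * s + D.mu j))⁻¹) *
        ∏ j, (Gamma (D.lam j * (1 - s) + conj (D.mu j)))⁻¹) * FE -
      ((D.Q : ℂ) ^ s * (∏ j, (Gamma (D.lam j * (1 - s) + conj (D.mu j)))⁻¹) * D.toFun s) * u1 +
      (D.rootNumber * (D.Q : ℂ) ^ (1 - s) * (∏ j, (Gamma (D.lam j * s + D.mu j))⁻¹) *
        conj (D.toFun (1 - conj s))) * u2

/-- The cofactor ("cross unit") `u₁₂(s) = ω₂ Q₂^{1-s} Q₁^s ∏ⱼ Γ(λ⁽¹⁾ⱼ (1-s) + conj μ⁽¹⁾ⱼ)⁻¹` of two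
Selberg data is entire. [folklore] -/
lemma differentiable_crossUnit (D₁ D₂ : SelbergDatum) :
    Differentiable ℂ fun s : ℂ ↦ D₂.rootNumber * (D₂.Q : ℂ) ^ (1 - s) * (D₁.Q : ℂ) ^ s *
      ∏ j, (Gamma (D₁.lam j * (1 - s) + conj (D₁.mu j)))⁻¹ := by
  refine ((Differentiable.mul ?_ ?_).mul ?_).mul ?_
  · exact differentiable_const _
  · exact ((differentiable_const _).sub differentiable_id).const_cpow (Or.inl D₂.Q_ne_zero)
  · exact differentiable_id.const_cpow (Or.inl D₁.Q_ne_zero)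
  · exact (differentiable_prod_inv_Gamma D₁.lam fun j ↦ conj (D₁.mu j)).comp
      ((differentiable_const _).sub differentiable_id)

/-- The cross unit `u₁₂(s) = ω₂ Q₂^{1-s} Q₁^s ∏ⱼ Γ(λ⁽¹⁾ⱼ (1-s) + conj μ⁽¹⁾ⱼ)⁻¹` is zero-free on
`re s < 1`. [folklore] -/
lemma crossUnit_ne_zero (D₁ D₂ : SelbergDatum) (s : ℂ) (hs : s.re < 1) :
    D₂.rootNumber * (D₂.Q : ℂ) ^ (1 - s) * (D₁.Q : ℂ) ^ s *
      ∏ j, (Gamma (D₁.lam j * (1 - s) + conj (D₁.mu j)))⁻¹ ≠ 0 := by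
  refine mul_ne_zero (mul_ne_zero (mul_ne_zero D₂.rootNumber_ne_zero ?_) ?_) ?_
  · exact Complex.cpow_ne_zero_iff.mpr (Or.inl D₂.Q_ne_zero)
  · exact Complex.cpow_ne_zero_iff.mpr (Or.inl D₁.Q_ne_zero)
  · exact prod_inv_Gamma_ne_zero D₁.lam (fun j ↦ conj (D₁.mu j)) (1 - s)
      (D₁.Gamma_lam_mul_one_sub_add_conj_mu_ne_zero s hs)

/-- On the open strip the two functional equations of a common `F` give
`u₁₂(s) P₂(s) F(s) = u₂₁(s) P₁(s) F(s)` ("cross gamma" identity times `F`). [folklore] -/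
lemma crossGamma_mul_toFun_eq (D₁ D₂ : SelbergDatum) (hF : D₁.toFun = D₂.toFun) (s : ℂ)
    (h0 : 0 < s.re) (h1 : s.re < 1) :
    D₂.rootNumber * (D₂.Q : ℂ) ^ (1 - s) * (D₁.Q : ℂ) ^ s *
        (∏ j, (Gamma (D₁.lam j * (1 - s) + conj (D₁.mu j)))⁻¹) *
        (∏ j, (Gamma (D₂.lam j * s + D₂.mu j))⁻¹) * D₁.toFun s =
      D₁.rootNumber * (D₁.Q : ℂ) ^ (1 - s) * (D₂.Q : ℂ) ^ s *
        (∏ j, (Gamma (D₂.lam j * (1 - s) + conj (D₂.mu j)))⁻¹) *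
        (∏ j, (Gamma (D₁.lam j * s + D₁.mu j))⁻¹) * D₁.toFun s := by
  have e1 := D₁.fe_prod_inv_Gamma s h0 h1
  have e2 := D₂.fe_prod_inv_Gamma s h0 h1
  rw [← hF] at e2
  linear_combination
    (D₂.rootNumber * (D₂.Q : ℂ) ^ (1 - s) * ∏ j, (Gamma (D₂.lam j * s + D₂.mu j))⁻¹) * e1 -
      (D₁.rootNumber * (D₁.Q : ℂ) ^ (1 - s) * ∏ j, (Gamma (D₁.lam j * s + D₁.mu j))⁻¹) * e2

/-- **Key identity.** For two Selberg data with the same function, the entire "cross gamma"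
functions `u₁₂ P₂` and `u₂₁ P₁` coincide on all of `ℂ` (identity theorem, twice: through the strip,
where their difference times `F` vanishes, and through `re s > 1`, where `F ≠ 0`). This is the
rigorous form of "`h = γ⁽¹⁾/γ⁽²⁾` is entire and non-vanishing" in Conrey–Ghosh, §2. [cite: ConreyGhosh1993, §2] -/
theorem crossGamma_comm (D₁ D₂ : SelbergDatum) (hF : D₁.toFun = D₂.toFun) (s : ℂ) :
    D₂.rootNumber * (D₂.Q : ℂ) ^ (1 - s) * (D₁.Q : ℂ) ^ s *
        (∏ j, (Gamma (D₁.lam j * (1 - s) + conj (D₁.mu j)))⁻¹) *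
        ∏ j, (Gamma (D₂.lam j * s + D₂.mu j))⁻¹ =
      D₁.rootNumber * (D₁.Q : ℂ) ^ (1 - s) * (D₂.Q : ℂ) ^ s *
        (∏ j, (Gamma (D₂.lam j * (1 - s) + conj (D₂.mu j)))⁻¹) *
        ∏ j, (Gamma (D₁.lam j * s + D₁.mu j))⁻¹ := by
  obtain ⟨G, hG, hGF⟩ := D₁.differentiable
  set Φ : ℂ → ℂ := fun s ↦
    D₂.rootNumber * (D₂.Q : ℂ) ^ (1 - s) * (D₁.Q : ℂ) ^ s *
        (∏ j, (Gamma (D₁.lam j * (1 - s) + conj (D₁.mu j)))⁻¹) *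
        ∏ j, (Gamma (D₂.lam j * s + D₂.mu j))⁻¹ -
      D₁.rootNumber * (D₁.Q : ℂ) ^ (1 - s) * (D₂.Q : ℂ) ^ s *
        (∏ j, (Gamma (D₂.lam j * (1 - s) + conj (D₂.mu j)))⁻¹) *
        ∏ j, (Gamma (D₁.lam j * s + D₁.mu j))⁻¹ with hΦ
  have hΦd : Differentiable ℂ Φ :=
    ((differentiable_crossUnit D₁ D₂).mul (differentiable_prod_inv_Gamma D₂.lam D₂.mu)).sub
      ((differentiable_crossUnit D₂ D₁).mul (differentiable_prod_inv_Gamma D₁.lam D₁.mu))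
  -- Step 1: `Φ · G ≡ 0`, since it vanishes on the open strip.
  have h1 : Φ * G = 0 := by
    have hana : AnalyticOnNhd ℂ (Φ * G) univ :=
      Complex.analyticOnNhd_univ_iff_differentiable.mpr (hΦd.mul hG)
    have hopen : IsOpen (Complex.re ⁻¹' Set.Ioo (0 : ℝ) 1) :=
      isOpen_Ioo.preimage Complex.continuous_re
    have hmem : (((1 / 2 : ℝ) : ℂ)) ∈ Complex.re ⁻¹' Set.Ioo (0 : ℝ) 1 := by
      simp only [Set.mem_preimage, Complex.ofReal_re, Set.mem_Ioo]; norm_num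
    have key : (Φ * G) =ᶠ[𝓝 (((1 / 2 : ℝ) : ℂ))] 0 := by
      filter_upwards [hopen.mem_nhds hmem] with s hs
      have hs' : 0 < s.re ∧ s.re < 1 := hs
      have hs1 : s ≠ 1 := fun h ↦ by rw [h, Complex.one_re] at hs'; exact lt_irrefl _ hs'.2
      have hc := crossGamma_mul_toFun_eq D₁ D₂ hF s hs'.1 hs'.2
      simp only [Pi.mul_apply, Pi.zero_apply, hGF s hs1, hΦ]
      linear_combination (s - 1) ^ D₁.polarOrder * hc
    funext z
    exact hana.eqOn_zero_of_preconnected_of_eventuallyEq_zero isPreconnected_univ (mem_univ _) key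
      (mem_univ z)
  -- Step 2: `Φ = 0` on `re s > 1`, where `G ≠ 0`.
  have h2 : Φ =ᶠ[𝓝 ((2 : ℝ) : ℂ)] 0 := by
    have hopen : IsOpen {s : ℂ | 1 < s.re} := isOpen_lt continuous_const Complex.continuous_re
    have hmem : ((2 : ℝ) : ℂ) ∈ {s : ℂ | 1 < s.re} := by
      simp only [Set.mem_setOf_eq, Complex.ofReal_re]; norm_num
    filter_upwards [hopen.mem_nhds hmem] with s hs
    have hs' : 1 < s.re := hs
    have hs1 : s ≠ 1 := fun h ↦ by rw [h, Complex.one_re] at hs'; exact lt_irrefl _ hs'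
    have hGs : G s ≠ 0 := by
      rw [hGF s hs1]
      exact mul_ne_zero (pow_ne_zero _ (sub_ne_zero.mpr hs1)) (D₁.toFun_ne_zero_of_one_lt_re s hs')
    have := congrFun h1 s
    simp only [Pi.mul_apply, Pi.zero_apply, mul_eq_zero] at this
    exact this.resolve_right hGs
  -- Step 3: identity theorem for `Φ`.
  have h3 : Φ = 0 := funext fun z ↦
    (Complex.analyticOnNhd_univ_iff_differentiable.mpr hΦd).eqOn_zero_of_preconnected_of_eventuallyEq_zero
      isPreconnected_univ (mem_univ _) h2 (mem_univ z)
  have h4 := congrFun h3 s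
  simp only [hΦ, Pi.zero_apply] at h4
  exact sub_eq_zero.mp h4

/-! ## Pole multiplicities agree -/

open scoped Classical in
/-- The order of vanishing at `s₀`, `re s₀ < 1`, of the cross gamma function `u₁₂ P₂` is the number
of gamma factors of `D₂` having a pole at `s₀`, i.e. of `j` with `λ⁽²⁾ⱼ s₀ + μ⁽²⁾ⱼ ∈ -ℕ` (the unit
`u₁₂` is analytic and zero-free there). [folklore] -/
lemma analyticOrderAt_crossGamma (D₁ D₂ : SelbergDatum) (s₀ : ℂ) (hs₀ : s₀.re < 1) :
    analyticOrderAt (fun s : ℂ ↦ D₂.rootNumber * (D₂.Q : ℂ) ^ (1 - s) * (D₁.Q : ℂ) ^ s *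
        (∏ j, (Gamma (D₁.lam j * (1 - s) + conj (D₁.mu j)))⁻¹) *
        ∏ j, (Gamma (D₂.lam j * s + D₂.mu j))⁻¹) s₀ =
      ((∑ j, if ∃ n : ℕ, (D₂.lam j : ℂ) * s₀ + D₂.mu j = -n then 1 else 0 : ℕ) : ℕ∞) := by
  have hu := (differentiable_crossUnit D₁ D₂).analyticAt s₀
  have hp := (differentiable_prod_inv_Gamma D₂.lam D₂.mu).analyticAt s₀
  rw [← analyticOrderAt_prod_inv_Gamma D₂.lam D₂.mu (fun j ↦ (D₂.lam_pos j).ne') s₀,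
    ← zero_add (analyticOrderAt (fun s : ℂ ↦ ∏ j, (Gamma (D₂.lam j * s + D₂.mu j))⁻¹) s₀),
    ← hu.analyticOrderAt_eq_zero.mpr (crossUnit_ne_zero D₁ D₂ s₀ hs₀), ← analyticOrderAt_mul hu hp]
  rfl

open scoped Classical in
/-- Two Selberg data with the same function have the same pole multiplicities of their gamma
products `∏ⱼ Γ(λⱼ s + μⱼ)` at every point of `re s < 1` (hence everywhere, all poles lying in
`re s ≤ 0`): the number of `j` with `λⱼ s₀ + μⱼ ∈ -ℕ` agrees (Conrey–Ghosh 1993, §2: "if the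
degrees were different, then `h` would have zeros or poles"). [cite: ConreyGhosh1993, §2] -/
theorem poleCount_eq_of_toFun_eq (D₁ D₂ : SelbergDatum) (hF : D₁.toFun = D₂.toFun) (s₀ : ℂ)
    (hs₀ : s₀.re < 1) :
    (∑ j, if ∃ n : ℕ, (D₁.lam j : ℂ) * s₀ + D₁.mu j = -n then 1 else 0) =
      ∑ j, if ∃ n : ℕ, (D₂.lam j : ℂ) * s₀ + D₂.mu j = -n then 1 else 0 := by
  have h12 := analyticOrderAt_crossGamma D₁ D₂ s₀ hs₀
  have h21 := analyticOrderAt_crossGamma D₂ D₁ s₀ hs₀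
  have hfun := funext fun s ↦ crossGamma_comm D₁ D₂ hF s
  rw [hfun, h21] at h12
  exact_mod_cast h12

/-! ## Counting poles -/

/-- `λⱼ ≠ 0` in `ℂ`. [folklore] -/
lemma lam_ne_zero (j : Fin D.numGamma) : (D.lam j : ℂ) ≠ 0 :=
  Complex.ofReal_ne_zero.mpr (D.lam_pos j).ne'

/-- The `n`-th pole `pⱼ(n) = -(n + μⱼ)/λⱼ` of `Γ(λⱼ s + μⱼ)` satisfies `λⱼ pⱼ(n) + μⱼ = -n`.
[folklore] -/
lemma lam_mul_polePt_add_mu (j : Fin D.numGamma) (n : ℕ) :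
    (D.lam j : ℂ) * (-((n : ℂ) + D.mu j) / (D.lam j : ℂ)) + D.mu j = -n := by
  field_simp [D.lam_ne_zero j]
  ring

/-- If `λⱼ s + μⱼ = -n` then `s` is the pole `-(n + μⱼ)/λⱼ`. [folklore] -/
lemma eq_polePt_of_eq (j : Fin D.numGamma) (n : ℕ) (s : ℂ) (h : (D.lam j : ℂ) * s + D.mu j = -n) :
    s = -((n : ℂ) + D.mu j) / (D.lam j : ℂ) := by
  rw [eq_div_iff (D.lam_ne_zero j)]
  linear_combination h

/-- `n ↦ -(n + μⱼ)/λⱼ` is injective. [folklore] -/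
lemma polePt_injective (j : Fin D.numGamma) :
    Function.Injective fun n : ℕ ↦ -((n : ℂ) + D.mu j) / (D.lam j : ℂ) := by
  intro n n' h
  have h1 := D.lam_mul_polePt_add_mu j n
  dsimp only at h
  rw [h, D.lam_mul_polePt_add_mu j n', neg_inj] at h1
  exact_mod_cast h1.symm

/-- `re (-(n + μⱼ)/λⱼ) = -(n + re μⱼ)/λⱼ`. [folklore] -/
lemma polePt_re (j : Fin D.numGamma) (n : ℕ) :
    (-((n : ℂ) + D.mu j) / (D.lam j : ℂ)).re = -((n : ℝ) + (D.mu j).re) / D.lam j := by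
  simp [Complex.div_ofReal_re]

/-- `#{n : n ≤ Y} = ⌊Y + 1⌋₊`: membership in `range ⌊λⱼ X - re μⱼ + 1⌋₊` means `n + re μⱼ ≤ λⱼ X`,
i.e. the pole `-(n + μⱼ)/λⱼ` has real part `≥ -X`. [folklore] -/
lemma mem_range_floor_iff (X : ℝ) (j : Fin D.numGamma) (n : ℕ) :
    n ∈ Finset.range ⌊D.lam j * X - (D.mu j).re + 1⌋₊ ↔ (n : ℝ) + (D.mu j).re ≤ D.lam j * X := by
  rw [Finset.mem_range]
  rcases lt_or_ge (D.lam j * X - (D.mu j).re + 1) 0 with h | h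
  · rw [Nat.floor_of_nonpos h.le]
    constructor
    · intro hn; exact absurd hn (Nat.not_lt_zero _)
    · intro hn; exfalso; have : (0 : ℝ) ≤ n := Nat.cast_nonneg n; linarith
  · rw [← Nat.succ_le_iff, Nat.succ_eq_add_one, Nat.le_floor_iff h]
    push_cast
    constructor <;> intro <;> linarith

/-- The poles `-(n + μⱼ)/λⱼ` with `n < ⌊λⱼ X - re μⱼ + 1⌋₊` have real part in `[-X, 0]`. [folklore] -/
lemma re_polePt_mem (X : ℝ) (j : Fin D.numGamma) (n : ℕ)
    (hn : n ∈ Finset.range ⌊D.lam j * X - (D.mu j).re + 1⌋₊) :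
    -X ≤ (-((n : ℂ) + D.mu j) / (D.lam j : ℂ)).re ∧ (-((n : ℂ) + D.mu j) / (D.lam j : ℂ)).re ≤ 0 := by
  rw [mem_range_floor_iff] at hn
  rw [polePt_re]
  have hl := D.lam_pos j
  have hμ := D.mu_re_nonneg j
  constructor
  · rw [neg_div, neg_le_neg_iff, div_le_iff₀ hl]; linarith
  · rw [neg_div, neg_nonpos]; positivity

open scoped Classical in
/-- Summing the pole multiplicities of `D` over a finite set `Z ⊆ {re s ≥ -X}` containing all poles
of `D` with real part `≥ -X` counts `∑ⱼ #{n : n + re μⱼ ≤ λⱼ X} = ∑ⱼ ⌊λⱼ X - re μⱼ + 1⌋₊`.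
[folklore] -/
lemma sum_poleCount (X : ℝ) (Z : Finset ℂ) (hZ : ∀ s ∈ Z, -X ≤ s.re)
    (hsub : ∀ j, ∀ n ∈ Finset.range ⌊D.lam j * X - (D.mu j).re + 1⌋₊,
      -((n : ℂ) + D.mu j) / (D.lam j : ℂ) ∈ Z) :
    ∑ s ∈ Z, (∑ j, if ∃ n : ℕ, (D.lam j : ℂ) * s + D.mu j = -n then 1 else 0) =
      ∑ j, ⌊D.lam j * X - (D.mu j).re + 1⌋₊ := by
  rw [Finset.sum_comm]
  refine Finset.sum_congr rfl fun j _ ↦ ?_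
  rw [← Finset.card_filter, ← Finset.card_range ⌊D.lam j * X - (D.mu j).re + 1⌋₊,
    ← Finset.card_image_of_injective _ (D.polePt_injective j)]
  congr 1
  ext s
  simp only [Finset.mem_filter, Finset.mem_image]
  constructor
  · rintro ⟨hs, n, hn⟩
    have hs' := D.eq_polePt_of_eq j n s hn
    refine ⟨n, ?_, hs'.symm⟩
    rw [mem_range_floor_iff]
    have := hZ s hs
    rw [hs', polePt_re, neg_div, neg_le_neg_iff, div_le_iff₀ (D.lam_pos j)] at this
    linarith
  · rintro ⟨n, hn, rfl⟩
    exact ⟨hsub j n hn, n, D.lam_mul_polePt_add_mu j n⟩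

open scoped Classical in
/-- If the pole multiplicities of `D₁` and `D₂` agree on `re s < 1`, then `∑ λ⁽¹⁾ ≤ ∑ λ⁽²⁾`:
counting the poles with real part `≥ -X` gives `(∑ λ⁽¹⁾) X - ∑ re μ⁽¹⁾ ≤ (∑ λ⁽²⁾) X + N₂` for all
`X ≥ 0`. [folklore] -/
theorem sum_lam_le_of_poleCount_eq (D₁ D₂ : SelbergDatum)
    (h : ∀ s : ℂ, s.re < 1 →
      (∑ j, if ∃ n : ℕ, (D₁.lam j : ℂ) * s + D₁.mu j = -n then 1 else 0) =
        ∑ j, if ∃ n : ℕ, (D₂.lam j : ℂ) * s + D₂.mu j = -n then 1 else 0) :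
    ∑ j, D₁.lam j ≤ ∑ j, D₂.lam j := by
  have key : ∀ X : ℝ, 0 ≤ X →
      (∑ j, D₁.lam j) * X - ∑ j, (D₁.mu j).re ≤ (∑ j, D₂.lam j) * X + D₂.numGamma := by
    intro X hX
    -- all poles of either datum with real part `≥ -X`
    set Z : Finset ℂ :=
      (Finset.univ.biUnion fun j ↦ (Finset.range ⌊D₁.lam j * X - (D₁.mu j).re + 1⌋₊).image
          fun n : ℕ ↦ -((n : ℂ) + D₁.mu j) / (D₁.lam j : ℂ)) ∪
        Finset.univ.biUnion fun j ↦ (Finset.range ⌊D₂.lam j * X - (D₂.mu j).re + 1⌋₊).image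
          fun n : ℕ ↦ -((n : ℂ) + D₂.mu j) / (D₂.lam j : ℂ) with hZdef
    have hZ : ∀ s ∈ Z, -X ≤ s.re ∧ s.re ≤ 0 := by
      intro s hs
      simp only [hZdef, Finset.mem_union, Finset.mem_biUnion, Finset.mem_univ, true_and,
        Finset.mem_image] at hs
      rcases hs with ⟨j, n, hn, rfl⟩ | ⟨j, n, hn, rfl⟩
      exacts [D₁.re_polePt_mem X j n hn, D₂.re_polePt_mem X j n hn]
    have hsub₁ : ∀ j, ∀ n ∈ Finset.range ⌊D₁.lam j * X - (D₁.mu j).re + 1⌋₊,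
        -((n : ℂ) + D₁.mu j) / (D₁.lam j : ℂ) ∈ Z := fun j n hn ↦ by
      refine Finset.mem_union_left _ ?_
      simp only [Finset.mem_biUnion, Finset.mem_univ, true_and, Finset.mem_image]
      exact ⟨j, n, hn, rfl⟩
    have hsub₂ : ∀ j, ∀ n ∈ Finset.range ⌊D₂.lam j * X - (D₂.mu j).re + 1⌋₊,
        -((n : ℂ) + D₂.mu j) / (D₂.lam j : ℂ) ∈ Z := fun j n hn ↦ by
      refine Finset.mem_union_right _ ?_
      simp only [Finset.mem_biUnion, Finset.mem_univ, true_and, Finset.mem_image]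
      exact ⟨j, n, hn, rfl⟩
    have e1 := D₁.sum_poleCount X Z (fun s hs ↦ (hZ s hs).1) hsub₁
    have e2 := D₂.sum_poleCount X Z (fun s hs ↦ (hZ s hs).1) hsub₂
    have hsum : ∑ s ∈ Z, (∑ j, if ∃ n : ℕ, (D₁.lam j : ℂ) * s + D₁.mu j = -n then 1 else 0) =
        ∑ s ∈ Z, (∑ j, if ∃ n : ℕ, (D₂.lam j : ℂ) * s + D₂.mu j = -n then 1 else 0) :=
      Finset.sum_congr rfl fun s hs ↦ h s (by linarith [(hZ s hs).2])
    have hE : ∑ j, (⌊D₁.lam j * X - (D₁.mu j).re + 1⌋₊ : ℝ) =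
        ∑ j, (⌊D₂.lam j * X - (D₂.mu j).re + 1⌋₊ : ℝ) := by
      exact_mod_cast congrArg (Nat.cast : ℕ → ℝ) (e1.symm.trans (hsum.trans e2))
    have lo : ∀ j, D₁.lam j * X - (D₁.mu j).re ≤ ⌊D₁.lam j * X - (D₁.mu j).re + 1⌋₊ := fun j ↦ by
      linarith [Nat.lt_floor_add_one (D₁.lam j * X - (D₁.mu j).re + 1)]
    have hi : ∀ j, (⌊D₂.lam j * X - (D₂.mu j).re + 1⌋₊ : ℝ) ≤ D₂.lam j * X + 1 := fun j ↦ by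
      rcases le_or_gt 0 (D₂.lam j * X - (D₂.mu j).re + 1) with h0 | h0
      · linarith [Nat.floor_le h0, D₂.mu_re_nonneg j]
      · rw [Nat.floor_of_nonpos h0.le]
        push_cast
        nlinarith [D₂.lam_pos j]
    calc (∑ j, D₁.lam j) * X - ∑ j, (D₁.mu j).re = ∑ j, (D₁.lam j * X - (D₁.mu j).re) := by
          rw [Finset.sum_mul, Finset.sum_sub_distrib]
      _ ≤ ∑ j, (⌊D₁.lam j * X - (D₁.mu j).re + 1⌋₊ : ℝ) := Finset.sum_le_sum fun j _ ↦ lo j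
      _ = ∑ j, (⌊D₂.lam j * X - (D₂.mu j).re + 1⌋₊ : ℝ) := hE
      _ ≤ ∑ j, (D₂.lam j * X + 1) := Finset.sum_le_sum fun j _ ↦ hi j
      _ = (∑ j, D₂.lam j) * X + D₂.numGamma := by
          rw [Finset.sum_add_distrib, Finset.sum_mul]; simp
  by_contra hlt
  push Not at hlt
  have hM : 0 ≤ ∑ j, (D₁.mu j).re := Finset.sum_nonneg fun j _ ↦ D₁.mu_re_nonneg j
  have hL : 0 < ∑ j, D₁.lam j - ∑ j, D₂.lam j := sub_pos.mpr hlt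
  set X : ℝ := (∑ j, (D₁.mu j).re + D₂.numGamma + 1) / (∑ j, D₁.lam j - ∑ j, D₂.lam j) with hXdef
  have hX0 : 0 ≤ X := by positivity
  have hX : (∑ j, D₁.lam j - ∑ j, D₂.lam j) * X = ∑ j, (D₁.mu j).re + D₂.numGamma + 1 :=
    mul_div_cancel₀ _ hL.ne'
  have := key X hX0
  rw [sub_mul] at hX
  linarith

/-! ## The discharge -/

/-- **The degree of an element of the Selberg class is well defined**: two Selberg data with the
same function `F` have the same degree `2 ∑ⱼ λⱼ` (Conrey–Ghosh, Duke Math. J. **72** (1993), §2,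
"Degree": the quotient of two admissible gamma factors is entire and zero-free, so the poles
`-(n + μⱼ)/λⱼ`, counted with multiplicity, coincide; counting those with real part `≥ -X` and
letting `X → ∞` gives `∑ λ⁽¹⁾ⱼ = ∑ λ⁽²⁾ₖ`). [cite: ConreyGhosh1993, §2] -/
theorem degree_eq_of_toFun_eq_holds : degree_eq_of_toFun_eq := by
  classical
  intro D₁ D₂ hF
  have h12 : ∀ s : ℂ, s.re < 1 →
      (∑ j, if ∃ n : ℕ, (D₁.lam j : ℂ) * s + D₁.mu j = -n then 1 else 0) =
        ∑ j, if ∃ n : ℕ, (D₂.lam j : ℂ) * s + D₂.mu j = -n then 1 else 0 := fun s hs ↦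
    poleCount_eq_of_toFun_eq D₁ D₂ hF s hs
  have h₁ := sum_lam_le_of_poleCount_eq D₁ D₂ h12
  have h₂ := sum_lam_le_of_poleCount_eq D₂ D₁ fun s hs ↦ (h12 s hs).symm
  simp only [degree]
  linarith

/-! ## The discharge of `riemannHypothesis_iff_of_toFun_eq_riemannZeta` -/

/-- **If the function of a Selberg datum is `ζ`, its strip-form Riemann hypothesis is equivalent to
Mathlib's `RiemannHypothesis`.** After rewriting `D.toFun = riemannZeta`, `D.RiemannHypothesis` is
literally `Literature.NumberTheory.LFunctions.RiemannHypothesisStrip` (`∀ s, ζ s = 0 → 0 < re s → re s < 1 → re s = 1/2`), and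
`RiemannHypothesis ↔ RiemannHypothesisStrip` is `Literature.NumberTheory.LFunctions.riemannHypothesis_iff_strip_holds`
(`GeneralizedRH.lean`), whose content is that the zeros of `ζ` outside the open critical strip are
exactly the trivial zeros: "`ζ(s)` has no zeros for `σ > 1` ... [and] no zeros for `σ < 0` except
for simple zeros at `s = -2, -4, -6, …`" (Titchmarsh §2.12, from the functional equation), and
"`ζ(s)` has no zeros on the line `σ = 1`" (Hadamard–de la Vallée Poussin 1896, Titchmarsh §3.1,
proofs §§3.2–3.4; Mathlib `riemannZeta_ne_zero_of_one_le_re`), whence none on `σ = 0`, `s ≠ 0`, by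
the functional equation again, and `ζ(0) = -1/2`. [cite: Titchmarsh1986, §2.12 and §3.1] -/
theorem riemannHypothesis_iff_of_toFun_eq_riemannZeta_holds :
    D.riemannHypothesis_iff_of_toFun_eq_riemannZeta := by
  intro h
  have e : _root_.RiemannHypothesis ↔ RiemannHypothesisStrip := riemannHypothesis_iff_strip_holds
  rw [e, SelbergDatum.RiemannHypothesis, RiemannHypothesisStrip, h]

/-! ## Holomorphy of the completed function (discharge of `differentiableOn_completed`) -/

/-- Discharge of the named fact `differentiableOn_completed`: the completed function
`Φ(s) = Q^s ∏ⱼ Γ(λⱼ s + μⱼ) F(s)` of a Selberg datum is holomorphic on `{s | 0 < re s, s ≠ 1}`.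
As in the source: `Q^s` is entire since `Q > 0`; `re (λⱼ s + μⱼ) = λⱼ re s + re μⱼ > 0` for
`re s > 0`, so `λⱼ s + μⱼ` is not a pole of `Γ`; and near every `s ≠ 1`,
`F(z) = G(z) / (z - 1)^m` with `G` the entire function of the continuation axiom (ii)
(Kaczorowski–Perelli survey, §1, axioms (ii)–(iii)). [cite: KaczorowskiPerelli1999, §1] -/
theorem differentiableOn_completed_holds : D.differentiableOn_completed := by
  rintro s ⟨hs₀, hs₁⟩
  refine DifferentiableAt.differentiableWithinAt ?_
  -- `F` is holomorphic at `s ≠ 1`.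
  have hF : DifferentiableAt ℂ D.toFun s := by
    obtain ⟨G, hG, hGF⟩ := D.differentiable
    have hpow : ((s - 1) ^ D.polarOrder : ℂ) ≠ 0 := pow_ne_zero _ (sub_ne_zero.mpr hs₁)
    have h : D.toFun =ᶠ[𝓝 s] fun z ↦ G z / (z - 1) ^ D.polarOrder := by
      filter_upwards [isOpen_ne.mem_nhds hs₁] with z hz
      rw [hGF z hz, mul_div_cancel_left₀ _ (pow_ne_zero _ (sub_ne_zero.mpr hz))]
    exact ((hG s).div ((differentiableAt_id.sub_const 1).pow _) hpow).congr_of_eventuallyEq h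
  -- `Q^s` is entire.
  have hQ : DifferentiableAt ℂ (fun z ↦ (D.Q : ℂ) ^ z) s :=
    differentiableAt_id.const_cpow (.inl D.Q_ne_zero)
  -- each gamma factor is holomorphic at `s`, since `re (λⱼ s + μⱼ) > 0`.
  have hΓ : ∀ j, DifferentiableAt ℂ (fun z ↦ Gamma (D.lam j * z + D.mu j)) s := by
    intro j
    have hre : 0 < ((D.lam j : ℂ) * s + D.mu j).re := by
      rw [re_lam_mul_add]
      exact add_pos_of_pos_of_nonneg (mul_pos (D.lam_pos j) hs₀) (D.mu_re_nonneg j)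
    refine (differentiableAt_Gamma _ fun m hm ↦ ?_).comp s
      ((differentiableAt_id.const_mul _).add_const _)
    rw [hm, neg_re, natCast_re] at hre
    linarith [m.cast_nonneg (α := ℝ)]
  show DifferentiableAt ℂ
    (fun z ↦ (D.Q : ℂ) ^ z * (∏ j, Gamma (D.lam j * z + D.mu j)) * D.toFun z) s
  exact (hQ.mul (DifferentiableAt.fun_finsetProd fun j _ ↦ hΓ j)).mul hF

end SelbergDatum

end Literature.NumberTheory.LFunctions
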